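import Summits.BirchSwinnertonDyer.Rank1Residual.AdditivePotMult.PotMultRankOneKatoCertificate
import Summits.BirchSwinnertonDyer.Rank1Residual.Additive.GordRankOneKatoCertificateBSD
import Summits.BirchSwinnertonDyer.Rank1Residual.AdditivePotMult.CycRankOneLambdaClass
import Summits.BirchSwinnertonDyer.Rank1Residual.Additive.CensusQ6UnitCoeffCertificate
import HarnessLib

/-!
# X4(M) at analytic rank ONE, EVERY odd `p` — WITH Delbourgo 2002 (M): Schneider PROVED, `Ш[p^∞]`
# finite, the EXACT `ℓ`-free identity, `BSD(E,p) ⟺` ONE `p`-adic valuation; the constant-term half of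
# the certificate is a THEOREM when `L(E,1) = 0`; the census Q6 record `n₀ = 1` IS the certificate
# (cell `b2b-bsdres`, team n1011, seat p07 (gen 2), OWNERS row T-O7KM; sequel of
# `PotMultRankOneKatoCertificate.lean`; the (M) twin of additive-p2 gen 19's
# `GordRankOneKatoCertificateBSD.lean`)

HONEST FRAMING (cell `b2b-bsdres`, run/shared/lean/b2b/bsd-rank1-residual/, verbatim in every
file): the goal of the cell is to DELETE the COMBINATION-SHAPED residual classes of the
Birch–Swinnerton-Dyer formula for ALL analytic-rank `≤ 1` elliptic curves over `ℚ` — "full BSD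
formula for every rank `≤ 1` curve in class `C`" assembled STRICTLY from published theorems — so
that the rank-`≤ 1` remainder becomes exactly the CONSTRUCTION-SHAPED classes, which are TYPED
(missing-input `Prop`s), NOT attempted. This is not "finishing BSD". Team n1011 (RESIDUAL-MAP §I
O7-ord, (M) share: X4(M) ∧ surj(p) ∧ `r_an = 1`, every odd `p`): research route on the
CONSTRUCTION-SHAPED class O7; labels and marks UNCHANGED; nothing booked; NO Literature fact minted;
no definition. THEOREMS ONLY; named facts enter as HYPOTHESES (`hK` = Kato's half-eigen reading
`Wuthrich2014.kato_halfEigenCharIdeal_dvd_cyclotomicPrime_of_surjective`; `hDelM` =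
`Delbourgo2002.mainTheorem_potMult` (A190, `p ≠ 2`); `hPal` = Pal 2012 Thm. 3.2 on the even branch;
GZK `hGZK`; modularity `hmod`, `hmodD`). No `_holds` of a named fact; debt 0.

## What this file proves (over `PotMultRankOneKatoCertificate.lean` §3: Kato + certificate ⟹
`X` torsion, `μ = 0`, `λ ≤ 1`, every odd `p`)

* §4 WITH Delbourgo 2002 (M) — ALL its hypotheses discharged on (M) by n1011-p16's bridge
  `ClassX4M.delbourgo2002` (no CM is automatic: CM `j` is integral; additivity; `ord_p j < 0`; the
  twist witness), and Delbourgo's anomalous proviso VACUOUS on (M) (`ℓ_p = 1`,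
  `PotMult.reductionNonAnomalous`): `ClassX4M.finite_shaPrimary_of_katoHalf_of_multCert` (`rank = 1`,
  NO GZK), `ClassX4M.schneider_and_padicVal_identity_rankOne_of_katoHalf_of_multCert` — Schneider's
  `Reg_p(E,Dh) ≠ 0` PROVED for every (B)-datum and the EXACT, `ℓ`-FREE identity
  `ord_p #Ш(E) + ord_p Reg_p(E,Dh) + ord_p ∏c_ℓ = 1 + 2·ord_p #E(ℚ)_tors` —,
  `ClassX4M.exists_leadingTermClauses_and_schneider_of_katoHalf_of_multCert`.
* §5 `ClassX4M.bsdp_iff_padicVal_rankOne_of_katoHalf_of_multCert`: **`BSD(E,p) ⟺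
  ord_p q + ord_p Reg_p(E,Dh) = 1`** (`L'(E,1) = q·Ω_E·Reg_∞`) on the certified X4(M) ∧ surj ∧
  `r_an = 1` rows at EVERY odd `p`; `…_of_padicVal_eq_one`; the LOWER half from one regulator
  inequality (`ClassX4M.missingLowerBoundAt_rankOne_…_of_regulatorCertificate`).
* §7 The certificate from ONE number: `constantCoeff_multBranch_eq_zero_of_entireLFunction_one_eq_zero`
  (the constant-term half is a THEOREM when `L(E,1) = 0`: interpolation
  `B(0) = ap⁻¹·∑(a/p)[a/p]^±` — additive-p4's `constantCoeff_padicLFunction{Plus,Minus}BranchMult_half`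
  — and Birch's formula for `E = E♭ ⊗ χ_{p*}`, additive-p1's `entireLFunction_one_eq_of_twist[_neg]`,
  Pal's `hPal` on the even branch), `multBranchUnitCertificateAt_of_norm_coeff_one`, and the Q6
  INTERLOCK (lead R5-18): census-ctyper1's record `CensusQ6.MultFirstUnitIndexAt W p 1` /
  `CensusQ6.MultOddFirstUnitIndexAt W p 1` (first unit coefficient at index `1`) ⟹ the certificate
  (`multBranchUnitCertificateAt_of_firstUnitIndex_one[_odd]`); headline
  `ClassX4M.bsdp_iff_padicVal_rankOne_of_katoHalf_of_norm_coeff_one`.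

Compared with the (G-ord) chain: NO `5 ≤ p`, NO `¬ W.HasCM`, NO `ReductionNonAnomalous`, NO `ℓ`.
Nothing booked; labels UNCHANGED; O7 OPEN.

References: D. Delbourgo, J. Number Theory 95 (2002) Thm. (A), (B), p. 39 [Delbourgo2002]; K. Kato,
Astérisque 295 (2004) Thm. 17.4 (3) [Kato2004Asterisque]; B. Mazur, J. Tate, J. Teitelbaum, Invent.
Math. 84 (1986) §I.10, §I.13–I.14 [MazurTateTeitelbaum1986Invent]; A. Pal, Canad. Math. Bull. 55 (2012)
Thm. 3.2 [Pal2012]; L. Washington, GTM 83 (1997) §7.1 [Washington1997]; R. L. Miller, LMS J. Comput.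
Math. 14 (2011) Def. 1.1 [Miller2011LMS].
-/

noncomputable section

open scoped Classical MatrixGroups ModularForm NumberField

namespace Summit.BirchSwinnertonDyer.Rank1Residual.AdditivePotMult

open CongruenceSubgroup WeierstrassCurve NumberField Literature.NumberTheory.EllipticCurves
  Literature.NumberTheory.EllipticCurves.ModularForms
  Literature.NumberTheory.EllipticCurves.Rank1Residual
  Literature.NumberTheory.EllipticCurves.Rank1Residual.Typed
  Literature.NumberTheory.EllipticCurves.Delbourgo2002
  Literature.NumberTheory.GaloisRepresentations
  Summit.BirchSwinnertonDyer.Rank1Residual.Additive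
  Summit.BirchSwinnertonDyer.Rank1Residual.X1.MuLambda
  Summit.BirchSwinnertonDyer.Rank1Residual.X1.RankOneParitySqueeze
  IsDedekindDomain

section Delbourgo

variable {W : WeierstrassCurve ℚ} [W.IsElliptic] [W.IsGloballyMinimal] {p : ℕ} [hp : Fact p.Prime]

/-! ### §4 With Delbourgo 2002 (M): Schneider PROVED, `Ш[p^∞]` finite, the EXACT `ℓ`-free identity -/

/-- **X4(M) ∩ {`ρ̄` onto}, EVERY odd `p`, `rank E(ℚ) = 1` (no GZK): `#Ш(E/ℚ)[p^∞] < ∞`** from Kato +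
the certificate (`CharLamLeAt W p 1 = CharLamLeAt W p rank`) and Delbourgo 2002 (M) (`hDelM`: (A)
torsion + a (B)-datum; n1011-p01/p16's `PotMult.finite_shaPrimary_of_charLamLe`).
[cite: Delbourgo2002, Theorem (A), (B) (p. 40)] [cite: Kato2004Asterisque, Thm. 17.4 (3) (p. 273)] -/
theorem ClassX4M.finite_shaPrimary_of_katoHalf_of_multCert
    (hDelM : Delbourgo2002.mainTheorem_potMult)
    (hK : Wuthrich2014.kato_halfEigenCharIdeal_dvd_cyclotomicPrime_of_surjective)
    (hmodD : nonempty_modularParametrizationData)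
    (hX : ClassX4M W p) (hsurj : Surj W p) (hr1 : W.mordellWeilRank = 1)
    (hcert : MultBranchUnitCertificateAt W p) :
    Finite (AddCommGroup.primaryComponent W.sha p) :=
  hX.potMult.finite_shaPrimary_of_charLamLe hDelM hX.p_ne_two
    (by rw [hr1]; exact hX.charLamLeAt_one_of_katoHalf_of_multCert hK hmodD hsurj hcert)

omit [W.IsGloballyMinimal] in
/-- **X4(M) ∩ {`ρ̄` onto}, EVERY odd `p`, `ord_{s=1} L(E,s) = 1`: for EVERY height datum `Dh` with
Delbourgo's (B)-clauses, Schneider's `Reg_p(E,Dh) ≠ 0` is PROVED (not certified) and the EXACT,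
`ℓ`-FREE identity `ord_p #Ш(E) + ord_p Reg_p(E,Dh) + ord_p ∏c_ℓ = 1 + 2·ord_p #E(ℚ)_tors` holds**
(additive-p2's cell-agnostic `schneider_and_padicVal_identity_rankOne_of_mu_zero_lam_le_one` with §3;
the factor `ℓ` is `1` by `PotMult.reductionNonAnomalous`; `Ш(E)` finite and `rank = 1` by GZK).
[cite: Delbourgo2002, Theorem (B) (p. 40), ℓ_p(E) = 1 (p. 39)] [cite: Kato2004Asterisque, Thm. 17.4 (3) (p. 273)]
[cite: Washington1997, §7.1] -/
theorem ClassX4M.schneider_and_padicVal_identity_rankOne_of_katoHalf_of_multCert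
    (hK : Wuthrich2014.kato_halfEigenCharIdeal_dvd_cyclotomicPrime_of_surjective)
    (hmodD : nonempty_modularParametrizationData)
    (hGZK : rank_eq_analyticRank_of_analyticRank_le_one)
    (hX : ClassX4M W p) (hsurj : Surj W p) (hr : W.analyticRank = 1)
    (hcert : MultBranchUnitCertificateAt W p)
    {Dh : PAdicHeightData W p} (hB : LeadingTermClauses W p Dh) :
    SchneiderConjecture Dh ∧
      (padicValNat p W.shaOrder : ℤ) + (padicRegulator Dh).valuation + padicValNat p W.tamagawaProduct =
        1 + 2 * padicValNat p W.torsionOrder := by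
  obtain ⟨hmw, hfinSha⟩ := hGZK W (by rw [hr])
  have hr1 : W.mordellWeilRank = 1 := by rw [hmw, hr]
  haveI : Finite W.sha := hfinSha
  obtain ⟨hS, -, ℓ, -, hℓ1, hid⟩ :=
    schneider_and_padicVal_identity_rankOne_of_mu_zero_lam_le_one (W := W) (p := p) hX.p_ne_two hr1 hB
      fun κ γ hκ hγ hγ' D fE hchar ↦
        hX.isTorsion_and_mu_zero_lam_le_one_of_katoHalf_of_multCert hK hmodD hsurj hcert hκ hγ hγ' D hchar
  refine ⟨hS, ?_⟩
  rw [hℓ1 (ClassX4M.potMult W p hX).reductionNonAnomalous, padicValNat_one_right, Nat.cast_zero,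
    add_zero, padicValNat_card_addPrimaryComponent] at hid
  exact hid

/-- **The height conjuncts are PROVED on the certified (M) rows**: X4(M) ∩ {`ρ̄` onto}, EVERY odd `p`,
`r_an = 1` ⟹ `∃ Dh, LeadingTermClauses W p Dh ∧ SchneiderConjecture Dh` — Delbourgo 2002 (M) supplies
`Dh` with EVERY hypothesis discharged on (M) (n1011-p16's `ClassX4M.delbourgo2002`: no CM automatic),
§4 its non-degeneracy. [cite: Delbourgo2002, Theorem (A), (B) (p. 40)] -/
theorem ClassX4M.exists_leadingTermClauses_and_schneider_of_katoHalf_of_multCert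
    (hDelM : Delbourgo2002.mainTheorem_potMult)
    (hK : Wuthrich2014.kato_halfEigenCharIdeal_dvd_cyclotomicPrime_of_surjective)
    (hmodD : nonempty_modularParametrizationData)
    (hGZK : rank_eq_analyticRank_of_analyticRank_le_one)
    (hX : ClassX4M W p) (hsurj : Surj W p) (hr : W.analyticRank = 1)
    (hcert : MultBranchUnitCertificateAt W p) :
    ∃ Dh : PAdicHeightData W p, LeadingTermClauses W p Dh ∧ SchneiderConjecture Dh := by
  obtain ⟨-, Dh, hB⟩ := hX.delbourgo2002 hDelM
  exact ⟨Dh, hB, (hX.schneider_and_padicVal_identity_rankOne_of_katoHalf_of_multCert hK hmodD hGZK hsurj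
    hr hcert hB).1⟩

/-! ### §5 `BSD(E,p)` ⟺ ONE valuation; the LOWER half from a regulator inequality -/

omit [W.IsGloballyMinimal] in
/-- **X4(M) ∩ {`ρ̄` onto}, EVERY odd `p` (`p = 3` included), `r_an = 1`: `BSD(E,p) ⟺
ord_p q + ord_p Reg_p(E,Dh) = 1`** for every (B)-datum `Dh` (in particular Delbourgo's `⟨,⟩_{p,ℚ}`),
where `L'(E,1) = q·Ω_E·Reg_∞(E)` — given Kato's divisibility and the one-number certificate. `Ш` has
disappeared: on the certified (M) rows of O7-ord the residue of `BSD(E,p)` is ONE `p`-adic valuation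
(the Disegni–Delbourgo comparison as an integer per pair). Nothing booked; O7 OPEN.
[cite: Delbourgo2002, Theorem (B) (p. 40)] [cite: Kato2004Asterisque, Thm. 17.4 (3) (p. 273)]
[cite: Miller2011LMS, Def. 1.1] -/
theorem ClassX4M.bsdp_iff_padicVal_rankOne_of_katoHalf_of_multCert
    (hK : Wuthrich2014.kato_halfEigenCharIdeal_dvd_cyclotomicPrime_of_surjective)
    (hmodD : nonempty_modularParametrizationData)
    (hGZK : rank_eq_analyticRank_of_analyticRank_le_one) (hmod : hasEntireLFunction_rat)
    (hX : ClassX4M W p) (hsurj : Surj W p) (hr : W.analyticRank = 1)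
    (hcert : MultBranchUnitCertificateAt W p)
    {Dh : PAdicHeightData W p} (hB : LeadingTermClauses W p Dh)
    {q : ℚ} (hLq : W.leadingLCoeff = (q : ℂ) * (W.realPeriodRat : ℂ) * (W.regulator : ℂ)) :
    BSDp W p ↔ padicValRat p q + (padicRegulator Dh).valuation = 1 := by
  obtain ⟨-, hid⟩ :=
    hX.schneider_and_padicVal_identity_rankOne_of_katoHalf_of_multCert hK hmodD hGZK hsurj hr hcert hB
  have hq0 : q ≠ 0 := by
    rintro rfl
    rw [Rat.cast_zero, zero_mul, zero_mul] at hLq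
    exact W.leadingLCoeff_ne_zero_holds (hmod W) hLq
  exact bsdp_iff_padicValRat_add_eq_one (W := W) (p := p) hGZK (by rw [hr]) hq0 hLq hid

omit [W.IsGloballyMinimal] in
/-- **X4(M) ∩ {`ρ̄` onto}, EVERY odd `p`, `r_an = 1`: `BSD(E,p)` from ONE `p`-adic equality** — the
certificate, a (B)-datum and `ord_p q + ord_p Reg_p(E,Dh) = 1`. [cite: Delbourgo2002, Theorem (B) (p. 40)]
[cite: Miller2011LMS, Def. 1.1] -/
theorem ClassX4M.bsdp_rankOne_of_katoHalf_of_multCert_of_padicVal_eq_one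
    (hK : Wuthrich2014.kato_halfEigenCharIdeal_dvd_cyclotomicPrime_of_surjective)
    (hmodD : nonempty_modularParametrizationData)
    (hGZK : rank_eq_analyticRank_of_analyticRank_le_one) (hmod : hasEntireLFunction_rat)
    (hX : ClassX4M W p) (hsurj : Surj W p) (hr : W.analyticRank = 1)
    (hcert : MultBranchUnitCertificateAt W p)
    {Dh : PAdicHeightData W p} (hB : LeadingTermClauses W p Dh)
    {q : ℚ} (hLq : W.leadingLCoeff = (q : ℂ) * (W.realPeriodRat : ℂ) * (W.regulator : ℂ))
    (hval : padicValRat p q + (padicRegulator Dh).valuation = 1) : BSDp W p :=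
  (hX.bsdp_iff_padicVal_rankOne_of_katoHalf_of_multCert hK hmodD hGZK hmod hsurj hr hcert hB hLq).mpr hval

/-- **X4(M) ∩ {`ρ̄` onto}, EVERY odd `p`, `r_an ≤ 1` with `rank E(ℚ) = 1`: the LOWER half
`Typed.MissingLowerBoundAt W p` from the certificate and ONE regulator inequality** for every (B)-datum
(`ord_p Reg_p(Dh) + ord_p #Ш_an + ord_p ∏c_ℓ ≤ 1 + 2·ord_p #tors`; n1011-p16's
`ClassX4M.missingLowerBoundAt_of_charLamLe_of_regulatorCertificate` fed with §3's `CharLamLeAt W p 1`).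
[cite: Delbourgo2002, Theorem (A), (B) (p. 40)] [cite: Miller2011LMS, Def. 1.1] -/
theorem ClassX4M.missingLowerBoundAt_rankOne_of_katoHalf_of_multCert_of_regulatorCertificate
    (hDelM : Delbourgo2002.mainTheorem_potMult)
    (hK : Wuthrich2014.kato_halfEigenCharIdeal_dvd_cyclotomicPrime_of_surjective)
    (hmodD : nonempty_modularParametrizationData)
    (hGZK : rank_eq_analyticRank_of_analyticRank_le_one)
    (hX : ClassX4M W p) (hsurj : Surj W p) (hr : W.analyticRank = 1)
    (hcert : MultBranchUnitCertificateAt W p) {s : ℚ} (hs : shaAn W = (s : ℂ))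
    (hreg : ∀ Dh : PAdicHeightData W p, LeadingTermClauses W p Dh →
      (padicRegulator Dh).valuation + padicValRat p s + padicValNat p W.tamagawaProduct ≤
        (W.mordellWeilRank : ℤ) + 2 * padicValNat p W.torsionOrder) :
    MissingLowerBoundAt W p := by
  obtain ⟨hmw, -⟩ := hGZK W (by rw [hr])
  have hr1 : W.mordellWeilRank = 1 := by rw [hmw, hr]
  exact hX.missingLowerBoundAt_of_charLamLe_of_regulatorCertificate hDelM hGZK (by rw [hr])
    (by rw [hr1]; exact hX.charLamLeAt_one_of_katoHalf_of_multCert hK hmodD hsurj hcert) hs hreg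


end Delbourgo

/-! ### §7 The certificate from ONE number; the Q6 record `n₀ = 1` IS the certificate (lead R5-18) -/

section OneNumber

variable {W : WeierstrassCurve ℚ} [W.IsElliptic] [W.IsGloballyMinimal] {p : ℕ} [hp : Fact p.Prime]

/-- **The constant-term half of the certificate is a THEOREM when `L(E,1) = 0`.** For `E = W`
additive at the odd prime `p` with `L(E,1) = 0` (e.g. `ord_{s=1} L(E,s) = 1`), `V = E♭` globally
minimal and MULTIPLICATIVE at `p` with `C • V^{(p*)} = W`, `f` the newform of `V`, `a_p(f) = ap` and
`ϖ` the period ratio of the parity of `(p−1)/2`: the Néron-normalised multiplicative branch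
`ϖ·L_p^{±}(f, ap, ω^{(p−1)/2}, T)` has constant term `0` — by INTERPOLATION
(`B(0) = ap⁻¹·∑_a (a/p)[a/p]^±_f`, additive-p4's `constantCoeff_padicLFunction{Plus,Minus}BranchMult_half`,
`p ∣ N`, `ap = ±1`) and Birch's formula `L(E,1) = ±ϖ·(∑…)·Ω_E[/(|u(C)|·c_∞)]` (additive-p1; Pal 2012
Thm. 3.2 = `hPal` at `p ≡ 1 (mod 4)`, PROVED at `p ≡ 3 (mod 4)`). So only the LINEAR coefficient is a
genuine per-pair computation. [cite: MazurTateTeitelbaum1986Invent, §I.13–I.14] [cite: Pal2012, Thm. 3.2] -/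
theorem constantCoeff_multBranch_eq_zero_of_entireLFunction_one_eq_zero
    (hPal : Pal2012.thm32_sqrt_mul_realPeriodRat_twist_eq_of_prime_one_mod_four)
    (hmod : hasEntireLFunction_rat) (hp2 : p ≠ 2) (hadd : Addv W p) (hL : W.entireLFunction 1 = 0)
    (V : WeierstrassCurve ℚ) [V.IsElliptic] [V.IsGloballyMinimal] (C : VariableChange ℚ)
    (hV : Mult V p) (hC : C • V.quadraticTwist ((-1 : ℚ) ^ (p / 2) * p) = W)
    {N : ℕ} [NeZero N] {f : CuspForm (Gamma0 N) 2} (hf : IsNewformOf V f) {ap : ℤ}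
    (hap : cuspCoeff f p = ap) (ϖ : ℚ)
    (hϖ : if Even (p / 2) then (ϖ : ℝ) * V.realPeriodRat = plusPeriod f
      else (ϖ : ℝ) * V.imaginaryPeriodRat = minusPeriod f) :
    PowerSeries.constantCoeff (PowerSeries.C (ϖ : ℚ_[p]) *
        (if Even (p / 2) then padicLFunctionPlusBranchMult f (ap : ℚ_[p]) (p / 2)
          else padicLFunctionMinusBranchMult f (ap : ℚ_[p]) (p / 2))) = 0 := by
  have hΩ : (W.realPeriodRat : ℂ) ≠ 0 := by exact_mod_cast W.realPeriodRat_pos_holds.ne'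
  -- `p ∣ N` and `ap = ±1`
  have hpN_ap : p ∣ N ∧ (ap = 1 ∨ ap = -1) := by
    by_cases hs : V.HasSplitMultiplicativeReductionAtPrime p
    · obtain ⟨h1, -⟩ := hf.cuspCoeff_eq_one_and_sq_of_split hs
      refine ⟨hf.dvd_level_of_split hs, Or.inl ?_⟩
      have : ((ap : ℤ) : ℂ) = ((1 : ℤ) : ℂ) := by push_cast; exact_mod_cast hap.symm.trans h1
      exact_mod_cast this
    · obtain ⟨h1, hpN⟩ := hf.cuspCoeff_eq_neg_one_and_dvd_of_nonsplit hV hs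
      refine ⟨hpN, Or.inr ?_⟩
      have : ((ap : ℤ) : ℂ) = ((-1 : ℤ) : ℂ) := by push_cast; exact_mod_cast hap.symm.trans h1
      exact_mod_cast this
  obtain ⟨hpN, hap1⟩ := hpN_ap
  have hap0 : (ap : ℚ_[p]) ≠ 0 := by
    rcases hap1 with rfl | rfl <;> norm_num
  have hodd : p % 4 = 1 ∨ p % 4 = 3 := by
    obtain ⟨k, hk⟩ := hp.out.odd_of_ne_two hp2
    omega
  rcases hodd with h1 | h3
  · have heven : Even (p / 2) := ⟨p / 4, by omega⟩
    have hC' : C • V.quadraticTwist (p : ℚ) = W := by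
      rw [pStar_eq_self_of_mod_four_eq_one h1] at hC; exact hC
    rw [if_pos heven] at hϖ
    rw [if_pos heven, map_mul, PowerSeries.constantCoeff_C,
      constantCoeff_padicLFunctionPlusBranchMult_half p hp2 hf.1 hf.coeffField_eq_bot hpN hap hap0]
    obtain ⟨ε, hε, hLq⟩ :=
      entireLFunction_one_eq_of_twist p hPal hmod h1 V W ⟨C, hC'⟩ (Or.inr hV) hadd hf ϖ hϖ
    rw [hL] at hLq
    have hzero : ε * (ϖ * legendrePlusSymbolSum f p) = 0 := by
      exact_mod_cast (mul_eq_zero.mp hLq.symm).resolve_right hΩ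
    have hε0 : ε ≠ 0 := by rcases hε with rfl | rfl <;> norm_num
    have hϖS : ϖ * legendrePlusSymbolSum f p = 0 := (mul_eq_zero.mp hzero).resolve_left hε0
    have hϖS' : (ϖ : ℚ_[p]) * (legendrePlusSymbolSum f p : ℚ_[p]) = 0 := by exact_mod_cast hϖS
    calc (ϖ : ℚ_[p]) * ((ap : ℚ_[p])⁻¹ * (legendrePlusSymbolSum f p : ℚ_[p]))
        = (ap : ℚ_[p])⁻¹ * ((ϖ : ℚ_[p]) * (legendrePlusSymbolSum f p : ℚ_[p])) := by ring
      _ = 0 := by rw [hϖS', mul_zero]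
  · have hnot : ¬ Even (p / 2) := by rw [Nat.not_even_iff_odd]; exact ⟨p / 4, by omega⟩
    have hC' : C • V.quadraticTwist (-(p : ℚ)) = W := by
      rw [pStar_eq_neg_of_mod_four_eq_three h3] at hC; exact hC
    rw [if_neg hnot] at hϖ
    rw [if_neg hnot, map_mul, PowerSeries.constantCoeff_C,
      constantCoeff_padicLFunctionMinusBranchMult_half p hp2 hf.1 hf.coeffField_eq_bot hpN hap hap0]
    obtain ⟨ε, hε, hLq⟩ := entireLFunction_one_eq_of_twist_neg p hmod h3 V W C hC' hadd hf ϖ hϖ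
    rw [hL] at hLq
    have hzero : ε * (ϖ * legendreMinusSymbolSum f p) /
        (|(C.u : ℚ)| * ((W.baseChange ℝ).numRealComponents : ℚ)) = 0 := by
      exact_mod_cast (mul_eq_zero.mp hLq.symm).resolve_right hΩ
    have hε0 : ε ≠ 0 := by rcases hε with rfl | rfl <;> norm_num
    have hua0 : |(C.u : ℚ)| ≠ 0 := abs_ne_zero.mpr C.u.ne_zero
    have hcinf0 : ((W.baseChange ℝ).numRealComponents : ℚ) ≠ 0 := by
      rw [numRealComponents]
      split_ifs <;> norm_num
    have hϖS : ϖ * legendreMinusSymbolSum f p = 0 := by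
      rcases div_eq_zero_iff.mp hzero with h | h
      · exact (mul_eq_zero.mp h).resolve_left hε0
      · exact absurd h (mul_ne_zero hua0 hcinf0)
    have hϖS' : (ϖ : ℚ_[p]) * (legendreMinusSymbolSum f p : ℚ_[p]) = 0 := by exact_mod_cast hϖS
    calc (ϖ : ℚ_[p]) * ((ap : ℚ_[p])⁻¹ * (legendreMinusSymbolSum f p : ℚ_[p]))
        = (ap : ℚ_[p])⁻¹ * ((ϖ : ℚ_[p]) * (legendreMinusSymbolSum f p : ℚ_[p])) := by ring
      _ = 0 := by rw [hϖS', mul_zero]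

/-- **The certificate from ONE number when `L(E,1) = 0`**: if every Néron-normalised multiplicative
branch of the twist has linear coefficient of `p`-adic norm `1` (`hone`; the per-pair computation),
then `MultBranchUnitCertificateAt W p`. [cite: Pal2012, Thm. 3.2] [cite: MazurTateTeitelbaum1986Invent, §I.13–I.14] -/
theorem multBranchUnitCertificateAt_of_norm_coeff_one
    (hPal : Pal2012.thm32_sqrt_mul_realPeriodRat_twist_eq_of_prime_one_mod_four)
    (hmod : hasEntireLFunction_rat) (hp2 : p ≠ 2) (hadd : Addv W p) (hL : W.entireLFunction 1 = 0)
    (hone : ∀ (V : WeierstrassCurve ℚ) [V.IsElliptic] [V.IsGloballyMinimal] (C : VariableChange ℚ),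
      Mult V p → C • V.quadraticTwist ((-1 : ℚ) ^ (p / 2) * p) = W →
      ∀ {N : ℕ} [NeZero N] (f : CuspForm (Gamma0 N) 2), IsNewformOf V f → ∀ (ap : ℤ), cuspCoeff f p = ap →
      ∀ ϖ : ℚ, (if Even (p / 2) then (ϖ : ℝ) * V.realPeriodRat = plusPeriod f
          else (ϖ : ℝ) * V.imaginaryPeriodRat = minusPeriod f) →
        ‖PowerSeries.coeff 1 (PowerSeries.C (ϖ : ℚ_[p]) *
            (if Even (p / 2) then padicLFunctionPlusBranchMult f (ap : ℚ_[p]) (p / 2)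
              else padicLFunctionMinusBranchMult f (ap : ℚ_[p]) (p / 2)))‖ = 1) :
    MultBranchUnitCertificateAt W p :=
  fun V _ _ C hV hC _ _ f hf ap hap ϖ hϖ ↦
    ⟨constantCoeff_multBranch_eq_zero_of_entireLFunction_one_eq_zero hPal hmod hp2 hadd hL V C hV hC hf
      hap ϖ hϖ, hone V C hV hC f hf ap hap ϖ hϖ⟩

/-- **Q6 INTERLOCK, even branch (`p ≡ 1 (mod 4)`)**: census-ctyper1's record
`MultFirstUnitIndexAt W p 1` ("the first `p`-adic unit coefficient of `ϖ·L_p⁺(f, ap, ω^{(p−1)/2}, T)` sits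
at index `1`") and `L(E,1) = 0` ⟹ `MultBranchUnitCertificateAt W p` (the constant term `0` by
interpolation). So the rank-`0` consumers (n1011-p06), the Q6 register and this rank-`1` chain share
ONE certificate currency. [cite: MazurTateTeitelbaum1986Invent, §I.13] [cite: Pal2012, Thm. 3.2] -/
theorem multBranchUnitCertificateAt_of_firstUnitIndex_one
    (hPal : Pal2012.thm32_sqrt_mul_realPeriodRat_twist_eq_of_prime_one_mod_four)
    (hmod : hasEntireLFunction_rat) (hp4 : p % 4 = 1) (hadd : Addv W p) (hL : W.entireLFunction 1 = 0)
    (hrec : CensusQ6.MultFirstUnitIndexAt W p 1) : MultBranchUnitCertificateAt W p := by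
  have hp2 : p ≠ 2 := by omega
  have heven : Even (p / 2) := ⟨p / 4, by omega⟩
  refine multBranchUnitCertificateAt_of_norm_coeff_one hPal hmod hp2 hadd hL ?_
  intro V _ _ C hV hC N _ f hf ap hap ϖ hϖ
  have hC' : C • V.quadraticTwist (p : ℚ) = W := by
    rw [pStar_eq_self_of_mod_four_eq_one hp4] at hC; exact hC
  rw [if_pos heven] at hϖ ⊢
  exact (hrec V C hV hC' f hf ap hap ϖ hϖ).2

/-- **Q6 INTERLOCK, odd branch (`p ≡ 3 (mod 4)`, `p = 3` included)**: `MultOddFirstUnitIndexAt W p 1`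
and `L(E,1) = 0` ⟹ `MultBranchUnitCertificateAt W p` (Pal for `d < 0` is a tree theorem: no `hPal`
is USED, it is carried for the uniform signature of `…_of_norm_coeff_one`).
[cite: MazurTateTeitelbaum1986Invent, §I.13] -/
theorem multBranchUnitCertificateAt_of_firstUnitIndex_one_odd
    (hPal : Pal2012.thm32_sqrt_mul_realPeriodRat_twist_eq_of_prime_one_mod_four)
    (hmod : hasEntireLFunction_rat) (hp4 : p % 4 = 3) (hadd : Addv W p) (hL : W.entireLFunction 1 = 0)
    (hrec : CensusQ6.MultOddFirstUnitIndexAt W p 1) : MultBranchUnitCertificateAt W p := by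
  have hp2 : p ≠ 2 := by omega
  have hodd : ¬ Even (p / 2) := by rw [Nat.not_even_iff_odd]; exact ⟨p / 4, by omega⟩
  refine multBranchUnitCertificateAt_of_norm_coeff_one hPal hmod hp2 hadd hL ?_
  intro V _ _ C hV hC N _ f hf ap hap ϖ hϖ
  have hC' : C • V.quadraticTwist (-(p : ℚ)) = W := by
    rw [pStar_eq_neg_of_mod_four_eq_three hp4] at hC; exact hC
  rw [if_neg hodd] at hϖ ⊢
  exact (hrec V C hV hC' f hf ap hap ϖ hϖ).2

/-- **HEADLINE (X4(M) ∩ {`ρ̄` onto}, EVERY odd `p`, `r_an = 1`): `BSD(E,p) ⟺ ord_p q + ord_p Reg_p(E,Dh) = 1`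
for every (B)-datum `Dh`, GIVEN Kato's divisibility and ONE `p`-adic unit** — the linear coefficient
of the Néron-normalised multiplicative branch of `E♭` (`hone`). All other inputs published (Kato
17.4 (3) half-eigen reading `hK`, Pal 2012 Thm. 3.2 `hPal` at `p ≡ 1 (mod 4)`, GZK, modularity) or
kernel. [cite: Kato2004Asterisque, Thm. 17.4 (3) (p. 273)] [cite: Delbourgo2002, Theorem (B) (p. 40)]
[cite: Pal2012, Thm. 3.2] [cite: Miller2011LMS, Def. 1.1] -/
theorem ClassX4M.bsdp_iff_padicVal_rankOne_of_katoHalf_of_norm_coeff_one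
    (hK : Wuthrich2014.kato_halfEigenCharIdeal_dvd_cyclotomicPrime_of_surjective)
    (hPal : Pal2012.thm32_sqrt_mul_realPeriodRat_twist_eq_of_prime_one_mod_four)
    (hmodD : nonempty_modularParametrizationData)
    (hGZK : rank_eq_analyticRank_of_analyticRank_le_one) (hmod : hasEntireLFunction_rat)
    (hX : ClassX4M W p) (hsurj : Surj W p) (hr : W.analyticRank = 1)
    (hone : ∀ (V : WeierstrassCurve ℚ) [V.IsElliptic] [V.IsGloballyMinimal] (C : VariableChange ℚ),
      Mult V p → C • V.quadraticTwist ((-1 : ℚ) ^ (p / 2) * p) = W →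
      ∀ {N : ℕ} [NeZero N] (f : CuspForm (Gamma0 N) 2), IsNewformOf V f → ∀ (ap : ℤ), cuspCoeff f p = ap →
      ∀ ϖ : ℚ, (if Even (p / 2) then (ϖ : ℝ) * V.realPeriodRat = plusPeriod f
          else (ϖ : ℝ) * V.imaginaryPeriodRat = minusPeriod f) →
        ‖PowerSeries.coeff 1 (PowerSeries.C (ϖ : ℚ_[p]) *
            (if Even (p / 2) then padicLFunctionPlusBranchMult f (ap : ℚ_[p]) (p / 2)
              else padicLFunctionMinusBranchMult f (ap : ℚ_[p]) (p / 2)))‖ = 1)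
    {Dh : PAdicHeightData W p} (hB : LeadingTermClauses W p Dh)
    {q : ℚ} (hLq : W.leadingLCoeff = (q : ℂ) * (W.realPeriodRat : ℂ) * (W.regulator : ℂ)) :
    BSDp W p ↔ padicValRat p q + (padicRegulator Dh).valuation = 1 :=
  hX.bsdp_iff_padicVal_rankOne_of_katoHalf_of_multCert hK hmodD hGZK hmod hsurj hr
    (multBranchUnitCertificateAt_of_norm_coeff_one hPal hmod hX.p_ne_two hX.classX4.2.1
      (entireLFunction_one_eq_zero_of_analyticRank_ne_zero hmod (by rw [hr]; exact one_ne_zero)) hone)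
    hB hLq

end OneNumber

end Summit.BirchSwinnertonDyer.Rank1Residual.AdditivePotMult

end
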